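import Literature.NumberTheory.ComplexMultiplication.CMTypeOrbitReduction
import Literature.NumberTheory.ComplexMultiplication.BlockOnesMatrixKernel
import HarnessLib

/-!
# Milne 1999 §6, proof of LEMMA 6.7 — the algebra in `ℤ[Γ]` and `ℤ[Γ/D]`: `ψ_i = τ_i + Σ_{j≠i} ιτ_j`, `ϖ_i`, the endomorphism
# «`ϵ ↦ ϵϖ₀`» of `ℤ[Γ/D]` has matrix `A(n/d, d)` in the basis `{σ_i, ισ_i}`, and (COROLLARY 6.6) its kernel is
# `{Σ a_i(σ_i + ισ_i) | Σ a_i = 0}` = the kernel of `ℤ[Γ/D] → X^*(L^Π)`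
# (J. S. Milne, *Lefschetz motives and the Tate conjecture*, Compositio Math. 117 (1999), §6 pp. 69–70)

Family `hodge`, lane `lit-hodgefound` (Layer A3; seat `lit-hodgefound-p27`, generation 17, row g17-#2); topic
`Literature/NumberTheory/ComplexMultiplication`, namespace `Literature.NumberTheory.ComplexMultiplication.CosetGerm`.  Sequel of g17-#1
`BlockOnesMatrixKernel` (`A(n, d)`, Prop. 6.5, Cor. 6.6) on the generic carriers of Q731/g16-#6 (`OrbitTorus.aug`, `act`, `rel`, `CharModule`,
`pushFun`).  GROUP-RING ALGEBRA ONLY: the objects of the completion of the proof of THEOREM 6.1 that live in `ℤ[Γ]` and `ℤ[Γ/D]` for an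
abstract finite group `Γ = Γ₀ × ⟨ι⟩` and a subgroup `D ⊂ Γ₀`, and the kernel computation of LEMMA 6.7 for ANY `ℤ`-linear map
`ℤ[Γ/D] → ℤ[Γ/D]` with the printed values on the basis; the number theory that produces this map (`K = Q·F`, `w₀`, `D = D(w₀)`,
`π ↦ f_π`, Lemma 5.1's diagram) is NOT here.  Definitions with bodies + THEOREMS; no named fact (D-0026, net debt 0).

THE PRINT.  [Milne1999] §6 p. 69 L1 – p. 70 L22 (held `paper:doi-10-1023-a-1000776613765` p0025–p0026), verbatim: «Thus `K = Q · F` with `F`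
totally real, and `Γ =_{df} Gal(K/ℚ)`, `Γ = Γ₀ × ⟨ι⟩`, `Γ₀ =_{df} Gal(K/Q) ≅ Gal(F/ℚ)`.  As a subfield of `ℚ^{al}`, `K` acquires a prime `w₀`.
Let `D = D(w₀) ⊂ Γ` be the decomposition group of `w₀`. Because `p` splits in `Q`, `D ⊂ Γ₀`.  Write `Γ₀ = {τ₀ = 1, …, τ_{n−1}}`, so that
`Γ = {τ₀, …, τ_{n−1}, ιτ₀, …, ιτ_{n−1}}`.  Let `d = (D : 1)`. We can assume that the `τ_i` have been numbered so that `D = {τ₀, …, τ_{d−1}}`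
and `τ_i D = τ_{d[i/d]} D` … In particular, `{τ₀, τ_d, …}` is a set of representatives for the cosets of `D` in `Γ`.  We shall use the map
`τ ↦ τw₀` to identify `Γ/D` with the set of primes of `K` lying over `p`. We have a commutative diagram (Lemma 5.1): [`X^*(S^K) ↪ ℤ[Γ]`,
`X^*(P^K) −(π ↦ f_π)→ ℤ[Γ/D]`] … the second [vertical map] is `Σ f(τ)τ ↦ Σ f(τ)(τD)`.  Let `ψ_i = τ_i + Σ_{j≠i} ιτ_j`, `ψ̄ = Σ ιτ_i`.
Then `ψ₀, …, ψ_{n−1}, ψ̄` form a basis for `X^*(S^K)` (Lemma 3.3). As `τ_iψ₀ = ψ_i`, `(ιτ_i)ψ₀ = ιψ_i` we see that `Ψ =_{df} {ψ₀, …, ψ_{n−1},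
ιψ₀, …, ιψ_{n−1}}` is a `Γ`-orbit in `X^*(S^K)`. Let `π_i = π(ψ_{id}) ∈ W^K_{1,+}(p^∞)`. Then `Π =_{df} {π₀, …, π_{(n/d)−1}, ιπ₀, …, ιπ_{(n/d)−1}}`
is a `Γ`-orbit in `X^*(P^K)`.  LEMMA 6.7. The diagram [`X^*(T^Ψ) → X^*(S^K)` over `X^*(L^Π) −X^*(β)→ X^*(P^K)`] becomes almost Cartesian
when the two groups at right are replaced by the images of the horizontal arrows.  Proof. We shall prove this by showing that the bottom
map is injective. The map `τ ↦ τπ₀` defines a bijection `Γ/D → Π`, and hence an isomorphism `ℤ[Γ/D] → ℤ[Π]`. On combining this with the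
natural map `ℤ[Π] → X^*(L^Π)`, we get the first map in the sequence `ℤ[Γ/D] → X^*(L^Π) −X^*(β)→ X^*(P^K) → ℤ[Γ/D]`. The map at right sends
`π` to the map `σ ↦ f_π(σw₀)`—it is injective (Section 4). Let `σ_i = τ_{di}D`, `i = 0, …, (n/d) − 1`, and let `ϖ_i = σ_i + dισ₀ + ⋯ +
dισ_{i−1} + (d − 1)ισ_i + dισ_{i+1} + ⋯ + dισ_{(n/d)−1} ∈ ℤ[Γ/D]`.  Then the composite of the three maps in the sequence is `ϵ ↦ ϵϖ₀ :
ℤ[Γ/D] → ℤ[Γ/D]`. Since `σ_iϖ₀ = ϖ_i`, `ισ_iϖ₀ = ιϖ_i`, this composite map has matrix `A(n/d, d)` relative to the basis `{σ₀, …,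
σ_{n/d−1}, ισ₀, …, ισ_{n/d−1}}` of `ℤ[Γ/D]`. Now Corollary 6.6 implies that the kernel of the composite map is `{Σ a_i(σ_i + ισ_i) |
Σ a_i = 0}`, but this is also the kernel of the map `ℤ[Γ/D] → X^*(L^Π)`.»

DICTIONARY.  §1 («in coordinates»): `J` = the index set `{0, …, n/d − 1}` of the `σ_i`, `ℤ[Γ/D]` in the basis `{σ_i} ⊔ {ισ_i}` = `J ⊕ J →₀ R`
(first summand `σ`, second `ισ`); `varpi d (inl i) = ϖ_i = σ_i − ισ_i + dΣ_k ισ_k`, `varpi d (inr i) = ιϖ_i`; `theta d` = the `R`-linear map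
with these values on the basis («`ϵ ↦ ϵϖ₀`»); `coe_theta`/`toMatrix_theta`: its matrix is g17-#1's `matA d = A(|J|, d)`; `theta_eq_zero_iff(_swap)`:
Corollary 6.6 read back on `ℤ[Γ/D]`.  §2 (Milne's `Γ`): `Setting ι Γ₀ D` = «`Γ = Γ₀ × ⟨ι⟩`, `D ⊂ Γ₀`» for an abstract finite group (`ι`
central of order `2` outside the index-`2` subgroup `Γ₀ ⊇ D`); `ℤ[Γ] = Γ →₀ R` with `Γ` acting by left translation (`OrbitTorus.act`),
`ℤ[Γ/D] = Γ ⧸ D →₀ R` (left cosets, Mathlib `Γ ⧸ D` for a non-normal subgroup, `Γ` acting by `MulAction.quotient`); `psi τ = ψ_τ = τ +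
Σ_{τ′ ∈ Γ₀, τ′ ≠ τ} ιτ′` (`τ ∈ Γ₀`; Milne's `ψ_i = ψ_{τ_i}`); «`Σ f(τ)τ ↦ Σ f(τ)(τD)`» = `OrbitTorus.pushFun R (↑)`; `halfCosets` = `{σ_i}` =
`{τD | τ ∈ Γ₀}` (a `Finset`), `frame` = the bijection `{σ_i} ⊔ {σ_i} ≃ Γ/D`, `inl σ ↦ σ`, `inr σ ↦ ισ` (Milne's numbering of `Γ/D` as
`{σ₀, …, ισ₀, …}`), `d = |D|` (`Fintype.card D`).  §3: for ANY linear `θ : ℤ[Γ/D] → ℤ[Γ/D]` with `θ(σ) = push(ψ_τ)` and `θ(ισ) = push(ιψ_τ)`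
(`σ = τD`, `τ ∈ Γ₀`) — the printed values of the composite, which come from Lemma 5.1's diagram — `toMatrix_eq_matA` («has matrix `A(n/d, d)`
relative to the basis …», basis `cosetBasis`), `mem_ker_iff` / **`ker_eq_rel`** (Cor. 6.6: the kernel is `{f | ιf = f, Σ f = 0}` =
`OrbitTorus.rel R (Γ ⧸ D) ι` = «the kernel of `ℤ[Γ/D] → X^*(L^Π)`», `X^*(L^Π) = OrbitTorus.CharModule`, along `Γ/D ≅ Π`), under the printed
hypothesis of Cor. 6.6 for `A(n/d, d)`: `d(2 − n) ≠ 0` and `2 ≠ 0` in `R` (`R = ℤ`: `|Γ₀| ≠ 2`, `int_ker_eq_rel`); and the conclusion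
mechanism **`injective_of_hasPrintedValues`**: if the composite `ℤ[Γ/D] ↠ X → M′ → ℤ[Γ/D]` through the character module `X = ℤ[Γ/D]/rel` has these
basis values, the middle map `X → M′` is injective («we shall prove this by showing that the bottom map is injective»).

WHAT IS HERE (all PROVED): §1 DEF `varpi` (`varpi_apply`), DEF **`theta`** (`theta_single`, **`coe_theta`**, **`toMatrix_theta`**,
**`theta_eq_zero_iff`**, `theta_eq_zero_iff_swap`); §2 DEF `Setting` (`smul_smul_eq`, `smul_coe_ne_coe`, `smul_ne_self`, **`isCMTypeWith`**: `Γ₀` is a CM type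
on the `Γ`-set `Γ` — skel-3's `IsCMTypeWith`), DEF **`psi`** (**`act_psi : τψ_{τ′} = ψ_{ττ′}`**, `act_iota_mul_psi : (ιτ)ψ_{τ′} = ι(ψ_{ττ′})`, `psi_apply`,
**`psi_apply_eq_milnePsi`**: `ψ_τ` = skel-3's `milnePsi ι Γ₀ τ`, so Lemma 3.3's basis is skel-3's `milneFamily`), `card_filter_coe_eq` (each coset `τD` has `d` elements),
DEF `halfCosets` (`coe_mem_halfCosets`, `exists_rep_of_mem_halfCosets`, `smul_not_mem_halfCosets`, `card_filter_mem_coe_eq`,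
**`card_halfCosets_mul_card : |{σ_i}|·d = |Γ₀|`**), DEF `frameFun` (`frameFun_injective`, `frameFun_surjective`), DEF **`frame`** (`frame_inl`,
`frame_inr`, `frame_symm_coe`, `frame_symm_smul_coe`, `smul_frame`), **`pushFun_psi : push(ψ_τ) = τD − ιτD + dΣ_i ισ_i`** (= `ϖ` of `τD`),
`pushFun_act_iota_psi`; §3 DEF `cosetBasis` (`cosetBasis_apply`, `cosetBasis_repr`), DEF `transport` (`transport_apply`), `card_hyp`
(`d ≠ 0 ∧ 2 − n ≠ 0 ⇒ d(2 − (n/d)d) ≠ 0`), DEF `HasPrintedValues` (the hypothesis structure on `θ`), **`transport_eq_theta`**,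
**`toMatrix_eq_matA`**, **`mem_ker_iff`**, `mem_rel_iff_forall`, **`ker_eq_rel`**, **`int_ker_eq_rel`**, `injective_of_comp_mkQ`,
**`injective_of_hasPrintedValues`**.

NOT here: `K = Q·F`, `w₀`, `D = D(w₀)`, the identification `Γ/D ≅ {w | p}` and `Γ/D ≅ Π` (`τ ↦ τπ₀`), the maps `X^*(β)`, `π ↦ f_π`, i.e. the
number-theoretic instance of `θ`, and LEMMAS 6.8–6.10 / the end of the proof of THEOREM 6.1 — later rows (the carriers are g16-#1…#7);
Theorem 6.1 itself is Layer B (B5-09).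

## References

* [Milne1999] J. S. Milne, *Lefschetz motives and the Tate conjecture*, Compositio Math. 117 (1999) 45–76 — §6 pp. 69–70, Lemma 6.7 and
  the paragraph before it (held `paper:doi-10-1023-a-1000776613765` p0025 L1–L60, p0026 L1–L40); Corollary 6.6 p. 68.

Provenance: lane `lit-hodgefound`, seat `lit-hodgefound-p27` gen 17 (agent `literature-prover-lit-hodgefound-p27-g17-0`), row g17-#2.
-/

set_option autoImplicit false

noncomputable section

namespace Literature.NumberTheory.ComplexMultiplication

namespace CosetGerm

open Finset BlockOnesMatrix OrbitTorus

/-! ### §1 In coordinates: `ℤ[Γ/D]` in the basis `{σ_i} ⊔ {ισ_i}`, the elements `ϖ_i`, `ιϖ_i` and the endomorphism «`ϵ ↦ ϵϖ₀`» -/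

section Coordinates

variable {J : Type*} [Fintype J] [DecidableEq J] {R : Type*} [CommRing R]

/-- **`ϖ_i` and `ιϖ_i`** in the basis `{σ_i} ⊔ {ισ_i}` (`= J ⊕ J`): `ϖ_i = σ_i + dισ₀ + ⋯ + (d − 1)ισ_i + ⋯ + dισ_{(n/d)−1} = σ_i − ισ_i +
dΣ_k ισ_k` (value at `inl i`) and `ιϖ_i = ισ_i − σ_i + dΣ_k σ_k` (value at `inr i`). [cite: Milne1999, §6 p. 70 (proof of Lemma 6.7)] -/
def varpi (d : R) : J ⊕ J → (J ⊕ J →₀ R)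
  | Sum.inl i => Finsupp.single (Sum.inl i) 1 - Finsupp.single (Sum.inr i) 1 + d • ∑ k, Finsupp.single (Sum.inr k) 1
  | Sum.inr i => Finsupp.single (Sum.inr i) 1 - Finsupp.single (Sum.inl i) 1 + d • ∑ k, Finsupp.single (Sum.inl k) 1

/-- The coefficients of `ϖ_t` are the `t`-th column of `A(n/d, d)`: `ϖ_t(s) = A(|J|, d)_{s,t}`. [cite: Milne1999, §6 p. 70 (proof of Lemma 6.7)] -/
theorem varpi_apply (d : R) (t s : J ⊕ J) : varpi d t s = matA d s t := by
  rcases t with j | j <;> rcases s with i | i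
  · simp [varpi, matA, Matrix.fromBlocks, Finsupp.single_apply, Matrix.one_apply, eq_comm]
  · simp [varpi, matA, Matrix.fromBlocks, Finsupp.single_apply, offBlock, Matrix.one_apply, eq_comm]
    ring
  · simp [varpi, matA, Matrix.fromBlocks, Finsupp.single_apply, offBlock, Matrix.one_apply, eq_comm]
    ring
  · simp [varpi, matA, Matrix.fromBlocks, Finsupp.single_apply, Matrix.one_apply, eq_comm]

/-- **The endomorphism «`ϵ ↦ ϵϖ₀`» of `ℤ[Γ/D]` in coordinates**: the `R`-linear map with `σ_i ↦ ϖ_i`, `ισ_i ↦ ιϖ_i` («Since `σ_iϖ₀ = ϖ_i`,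
`ισ_iϖ₀ = ιϖ_i` …»). [cite: Milne1999, §6 p. 70 (proof of Lemma 6.7)] -/
def theta (d : R) : (J ⊕ J →₀ R) →ₗ[R] (J ⊕ J →₀ R) :=
  Finsupp.linearCombination R (varpi d)

omit [DecidableEq J] in
/-- `θ(rδ_t) = rϖ_t`. [cite: Milne1999, §6 p. 70 (proof of Lemma 6.7)] -/
theorem theta_single (d : R) (t : J ⊕ J) (r : R) : theta d (Finsupp.single t r) = r • varpi d t := by
  simp [theta, Finsupp.linearCombination_single]

/-- **In coordinates `θ` is multiplication by `A(n/d, d)`**: `θ(f)(s) = Σ_t A_{s,t} f(t)`. [cite: Milne1999, §6 p. 70 (proof of Lemma 6.7)] -/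
theorem coe_theta (d : R) (f : J ⊕ J →₀ R) : ⇑(theta d f) = Matrix.mulVec (matA d) ⇑f := by
  ext s
  rw [theta, Finsupp.linearCombination_apply, Finsupp.sum_fintype f (fun i (a : R) => a • varpi d i) (fun _ => zero_smul _ _),
    Finsupp.finsetSum_apply]
  simp only [Finsupp.smul_apply, smul_eq_mul, varpi_apply, Matrix.mulVec, dotProduct]
  exact Finset.sum_congr rfl fun t _ => mul_comm _ _

/-- **«this composite map has matrix `A(n/d, d)` relative to the basis `{σ₀, …, σ_{n/d−1}, ισ₀, …, ισ_{n/d−1}}`»** (coordinate form: the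
matrix of `θ` in the standard basis of `J ⊕ J →₀ R` is `A(|J|, d)`). [cite: Milne1999, §6 p. 70 (proof of Lemma 6.7)] -/
theorem toMatrix_theta (d : R) :
    LinearMap.toMatrix Finsupp.basisSingleOne Finsupp.basisSingleOne (theta (J := J) d) = matA d := by
  ext s t
  rw [LinearMap.toMatrix_apply, Finsupp.coe_basisSingleOne, Finsupp.basisSingleOne_repr, LinearEquiv.refl_apply, theta_single,
    one_smul, varpi_apply]

/-- **«Corollary 6.6 implies that the kernel of the composite map is `{Σ a_i(σ_i + ισ_i) | Σ a_i = 0}`»** (coordinate form): for `R` without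
zero divisors and `d(2 − |J|d) ≠ 0`, `θ f = 0 ⟺ f(σ_i) = f(ισ_i)` for all `i` and `Σ_i f(σ_i) = 0`. [cite: Milne1999, §6 p. 70 (proof of
Lemma 6.7); p. 68 Corollary 6.6] -/
theorem theta_eq_zero_iff [NoZeroDivisors R] {d : R} (hd : d * (2 - (Fintype.card J : R) * d) ≠ 0) (f : J ⊕ J →₀ R) :
    theta d f = 0 ↔ (∀ i, f (Sum.inl i) = f (Sum.inr i)) ∧ ∑ i, f (Sum.inl i) = 0 := by
  rw [← Finsupp.coe_eq_zero, coe_theta, matA_mulVec_eq_zero_iff hd]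

/-- The same kernel as «`ιf = f` and `Σ f = 0`» (the relations defining `X^*(L^Π)`), for `2 ≠ 0` in `R`: `θ f = 0 ⟺ f ∘ swap = f` and
`Σ_s f(s) = 0`. [cite: Milne1999, §6 p. 70 (proof of Lemma 6.7)] -/
theorem theta_eq_zero_iff_swap [NoZeroDivisors R] (h2 : (2 : R) ≠ 0) {d : R} (hd : d * (2 - (Fintype.card J : R) * d) ≠ 0)
    (f : J ⊕ J →₀ R) : theta d f = 0 ↔ (∀ s, f (Sum.swap s) = f s) ∧ ∑ s, f s = 0 := by
  rw [theta_eq_zero_iff hd, Fintype.sum_sum_type]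
  constructor
  · rintro ⟨h, hs⟩
    refine ⟨fun s => ?_, ?_⟩
    · rcases s with j | j
      · rw [Sum.swap_inl]
        exact (h j).symm
      · rw [Sum.swap_inr]
        exact h j
    · rw [show ∑ j, f (Sum.inr j) = ∑ j, f (Sum.inl j) from Finset.sum_congr rfl fun j _ => (h j).symm, hs, add_zero]
  · rintro ⟨h, hs⟩
    have h' : ∀ j, f (Sum.inl j) = f (Sum.inr j) := fun j => by
      have := h (Sum.inr j)
      rwa [Sum.swap_inr] at this
    refine ⟨h', ?_⟩
    rw [show ∑ j, f (Sum.inr j) = ∑ j, f (Sum.inl j) from Finset.sum_congr rfl fun j _ => (h' j).symm, ← two_mul] at hs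
    exact (mul_eq_zero.mp hs).resolve_left h2

end Coordinates

/-! ### §2 Milne's `Γ = Γ₀ × ⟨ι⟩ ⊇ Γ₀ ⊇ D`: the elements `ψ_τ ∈ ℤ[Γ]`, the cosets `σ_i`, the push `ℤ[Γ] → ℤ[Γ/D]` -/

section Setting

variable {Γ : Type*} [Group Γ] {ι : Γ} {Γ₀ D : Subgroup Γ}

variable (ι Γ₀ D) in
/-- **The hypotheses «`Γ = Γ₀ × ⟨ι⟩`, `D ⊂ Γ₀`»** on an abstract group: `ι` is central with `ι² = 1`, `ι ∉ Γ₀`, `Γ = Γ₀ ∪ ιΓ₀`, and `D ≤ Γ₀`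
(for `K = Q·F`: `Γ = Gal(K/ℚ)`, `ι` = complex conjugation, `Γ₀ = Gal(K/Q)`, `D = D(w₀)` — «Because `p` splits in `Q`, `D ⊂ Γ₀`»).
[cite: Milne1999, §6 p. 69 L1–L14] -/
structure Setting : Prop where
  /-- `ι` is central -/
  comm : ∀ γ : Γ, ι * γ = γ * ι
  /-- `ι² = 1` -/
  mul_self : ι * ι = 1
  /-- `ι ∉ Γ₀` -/
  not_mem : ι ∉ Γ₀
  /-- `Γ = Γ₀ ∪ ιΓ₀` -/
  mem_or_mem : ∀ γ : Γ, γ ∈ Γ₀ ∨ ι * γ ∈ Γ₀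
  /-- `D ⊂ Γ₀` -/
  le : D ≤ Γ₀

/-- `ι(ισ) = σ` on `Γ/D`. [cite: Milne1999, §6 p. 69 L1–L14] -/
theorem Setting.smul_smul_eq (h : Setting ι Γ₀ D) (c : Γ ⧸ D) : ι • ι • c = c := by
  rw [smul_smul, h.mul_self, one_smul]

/-- `ιτ′D ≠ τD` for `τ, τ′ ∈ Γ₀` (else `ι·τ′⁻¹τ ∈ D ⊂ Γ₀` and `ι ∈ Γ₀`): the cosets `ισ_i` are distinct from the `σ_j`.
[cite: Milne1999, §6 p. 69 L10–L14] -/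
theorem Setting.smul_coe_ne_coe (h : Setting ι Γ₀ D) {τ τ' : Γ} (hτ : τ ∈ Γ₀) (hτ' : τ' ∈ Γ₀) :
    ι • (τ' : Γ ⧸ D) ≠ (τ : Γ ⧸ D) := by
  intro e
  rw [MulAction.Quotient.smul_coe, smul_eq_mul, QuotientGroup.eq] at e
  have hιinv : ι⁻¹ = ι := inv_eq_of_mul_eq_one_right h.mul_self
  have hx : τ'⁻¹ * τ ∈ Γ₀ := Γ₀.mul_mem (Γ₀.inv_mem hτ') hτ
  have e' : ι * (τ'⁻¹ * τ) ∈ Γ₀ := by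
    have e2 := h.le e
    rw [mul_inv_rev, hιinv, ← h.comm, mul_assoc] at e2
    exact e2
  have : ι * (τ'⁻¹ * τ) * (τ'⁻¹ * τ)⁻¹ ∈ Γ₀ := Γ₀.mul_mem e' (Γ₀.inv_mem hx)
  rw [mul_inv_cancel_right] at this
  exact h.not_mem this

/-- `ι` acts freely on `Γ/D`: `ιc ≠ c`. [cite: Milne1999, §6 p. 69 L10–L14] -/
theorem Setting.smul_ne_self (h : Setting ι Γ₀ D) (c : Γ ⧸ D) : ι • c ≠ c := by
  induction c using QuotientGroup.induction_on with | H γ => ?_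
  rcases h.mem_or_mem γ with hγ | hγ
  · exact h.smul_coe_ne_coe hγ hγ
  · intro e
    have e' : ι • ((ι * γ : Γ) : Γ ⧸ D) = ((ι * γ : Γ) : Γ ⧸ D) := by
      rw [MulAction.Quotient.smul_coe, smul_eq_mul, ← mul_assoc, h.mul_self, one_mul, ← e, MulAction.Quotient.smul_coe,
        smul_eq_mul]
    exact h.smul_coe_ne_coe hγ hγ e'

/-- **`Γ₀` is a CM type on the `Γ`-set `Γ`** (left translation) for `ι`, in the sense of the tree's `IsCMTypeWith` (skel-3, `CMTypeRank`):
`x ∈ Γ₀ ⟺ ιx ∉ Γ₀`, `ι` commutes with the action, `ι² = 1` — so skel-3's `milnePsi ι Γ₀`, `milneBar Γ₀`, `infinityTypes Γ Γ ι` (Milne CM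
Prop. 4.12 = [Milne1999] Lemma 3.3: «`ψ₀, …, ψ_{n−1}, ψ̄` form a basis for `X^*(S^K)`») apply to this setting. [cite: Milne1999, §6 p. 69
L1–L8, L22–L24] -/
theorem Setting.isCMTypeWith (h : Setting ι Γ₀ D) : IsCMTypeWith ι (Γ₀ : Set Γ) where
  mem_iff x := by
    simp only [SetLike.mem_coe, smul_eq_mul]
    constructor
    · intro hx hιx
      have : ι * x * x⁻¹ ∈ Γ₀ := Γ₀.mul_mem hιx (Γ₀.inv_mem hx)
      rw [mul_inv_cancel_right] at this
      exact h.not_mem this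
    · exact fun hιx => (h.mem_or_mem x).resolve_right hιx
  comm g x := by simp only [smul_eq_mul, ← mul_assoc, h.comm g]
  invol x := by rw [smul_eq_mul, smul_eq_mul, ← mul_assoc, h.mul_self, one_mul]

variable [Fintype Γ] [DecidablePred (· ∈ Γ₀)] [DecidablePred (· ∈ D)]
variable (R : Type*) [CommRing R]

section Psi

variable [DecidableEq Γ]

variable (ι Γ₀) in
/-- **`ψ_τ = τ + Σ_{τ′ ∈ Γ₀, τ′ ≠ τ} ιτ′ ∈ ℤ[Γ]`** (`τ ∈ Γ₀`; Milne's `ψ_i = τ_i + Σ_{j≠i} ιτ_j`, the CM type `{τ_i} ∪ {ιτ_j | j ≠ i}` as an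
element of `ℤ[Γ] ⊇ X^*(S^K)`). [cite: Milne1999, §6 p. 69 L22–L24] -/
def psi (τ : Γ) : Γ →₀ R :=
  Finsupp.single τ 1 + ∑ τ' ∈ (univ.filter (· ∈ Γ₀)).erase τ, Finsupp.single (ι * τ') 1

omit [DecidablePred (· ∈ D)] in
/-- **«As `τ_iψ₀ = ψ_i` …»**: left translation by `τ ∈ Γ₀` carries `ψ_{τ′}` to `ψ_{ττ′}` (`τ(ιτ″) = ι(ττ″)`, and `τ″ ↦ ττ″` permutes
`Γ₀ ∖ {τ′} → Γ₀ ∖ {ττ′}`). [cite: Milne1999, §6 p. 69 L24–L26] -/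
theorem act_psi (h : Setting ι Γ₀ D) {τ τ' : Γ} (hτ : τ ∈ Γ₀) :
    act R τ (psi ι Γ₀ R τ') = psi ι Γ₀ R (τ * τ') := by
  rw [psi, psi, map_add, act_single, smul_eq_mul, map_sum]
  congr 1
  refine Finset.sum_equiv (Equiv.mulLeft τ) (fun τ'' => ?_) (fun τ'' _ => ?_)
  · simp only [mem_erase, mem_filter, mem_univ, true_and, Equiv.coe_mulLeft, ne_eq, mul_right_inj]
    exact and_congr_right fun _ => ⟨fun h' => Γ₀.mul_mem hτ h', fun h' => by simpa using Γ₀.mul_mem (Γ₀.inv_mem hτ) h'⟩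
  · rw [act_single, smul_eq_mul, Equiv.coe_mulLeft, ← mul_assoc, ← h.comm τ, mul_assoc]

omit [DecidablePred (· ∈ D)] in
/-- **«… `(ιτ_i)ψ₀ = ιψ_i`»**: `(ιτ)ψ_{τ′} = ι(ψ_{ττ′})`, so `Ψ = {ψ_τ, ιψ_τ | τ ∈ Γ₀}` is the `Γ`-orbit of `ψ₀ = ψ_1`.
[cite: Milne1999, §6 p. 69 L24–L26] -/
theorem act_iota_mul_psi (h : Setting ι Γ₀ D) {τ τ' : Γ} (hτ : τ ∈ Γ₀) :
    act R (ι * τ) (psi ι Γ₀ R τ') = act R ι (psi ι Γ₀ R (τ * τ')) := by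
  rw [act_mul, LinearMap.comp_apply, act_psi R h hτ]

omit [DecidablePred (· ∈ D)] in
/-- The values of `ψ_τ`: `ψ_τ(x) = [x = τ] + [ιx ∈ Γ₀, ιx ≠ τ]`. [cite: Milne1999, §6 p. 69 L22–L24] -/
theorem psi_apply (h : Setting ι Γ₀ D) (τ x : Γ) :
    psi ι Γ₀ R τ x = (if τ = x then 1 else 0) + if ι * x ≠ τ ∧ ι * x ∈ Γ₀ then 1 else 0 := by
  have hιι : ∀ y : Γ, ι * (ι * y) = y := fun y => by rw [← mul_assoc, h.mul_self, one_mul]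
  have hiff : ∀ τ' : Γ, (ι * τ' = x) = (τ' = ι * x) := fun τ' =>
    propext ⟨fun e => by rw [← e, hιι], fun e => by rw [e, hιι]⟩
  rw [psi, Finsupp.add_apply, Finsupp.single_apply, Finsupp.finsetSum_apply]
  congr 1
  simp_rw [Finsupp.single_apply, hiff]
  rw [Finset.sum_ite_eq']
  simp only [Finset.mem_erase, Finset.mem_filter, Finset.mem_univ, true_and]

omit [DecidablePred (· ∈ D)] in
/-- **Dictionary: `ψ_τ` IS skel-3's `milnePsi ι Γ₀ τ`** (Milne CM Prop. 4.12's `ψᵢ = φᵢ + Σ_{j≠i} ιφⱼ` for the CM type `Φ = Γ₀` on `E = Γ`),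
read in `R[Γ]`; so [Milne1999]'s `Ψ`-basis statements are skel-3's `milneFamily` results. [cite: Milne1999, §6 p. 69 L22–L24] -/
theorem psi_apply_eq_milnePsi (h : Setting ι Γ₀ D) {τ : Γ} (hτ : τ ∈ Γ₀) (x : Γ) :
    psi ι Γ₀ R τ x = (milnePsi ι (Γ₀ : Set Γ) ⟨τ, hτ⟩ x : R) := by
  have hιι : ι * (ι * x) = x := by rw [← mul_assoc, h.mul_self, one_mul]
  have hc := h.isCMTypeWith
  rw [psi_apply R h]
  by_cases hx : x ∈ Γ₀
  · have hιx : ι * x ∉ Γ₀ := fun h' => (hc.mem_iff x).1 hx h'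
    rw [if_neg (show ¬(ι * x ≠ τ ∧ ι * x ∈ Γ₀) from fun hh => hιx hh.2), add_zero]
    by_cases hxt : τ = x
    · subst hxt
      rw [if_pos rfl, hc.milnePsi_apply_self ⟨τ, hτ⟩, Int.cast_one]
    · rw [if_neg hxt, hc.milnePsi_apply_of_mem (φ := ⟨τ, hτ⟩) hx (Ne.symm hxt), Int.cast_zero]
  · have hιx : ι * x ∈ Γ₀ := (h.mem_or_mem x).resolve_left hx
    have hxτ : τ ≠ x := fun e => hx (e ▸ hτ)
    rw [if_neg hxτ, zero_add]
    have ex : x = ι • (ι * x : Γ) := by rw [smul_eq_mul, hιι]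
    by_cases hyt : ι * x = τ
    · rw [if_neg (show ¬(ι * x ≠ τ ∧ ι * x ∈ Γ₀) from fun hh => hh.1 hyt), ex, hyt, hc.milnePsi_apply_smul_self ⟨τ, hτ⟩,
        Int.cast_zero]
    · rw [if_pos (show ι * x ≠ τ ∧ ι * x ∈ Γ₀ from ⟨hyt, hιx⟩), ex, hc.milnePsi_apply_smul_of_mem (φ := ⟨τ, hτ⟩) hιx hyt,
        Int.cast_one]

end Psi

omit [DecidablePred (· ∈ Γ₀)] in
/-- Each coset `τD` has `d = |D|` elements: `#{τ′ ∈ Γ | τ′D = τD} = |D|` («`D = {τ₀, …, τ_{d−1}}` and `τ_iD = τ_{d[i/d]}D`»).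
[cite: Milne1999, §6 p. 69 L10–L14] -/
theorem card_filter_coe_eq (τ : Γ) : (univ.filter fun τ' : Γ => (τ' : Γ ⧸ D) = (τ : Γ ⧸ D)).card = Fintype.card D := by
  rw [← Fintype.card_coe]
  refine Fintype.card_congr (Equiv.ofBijective (fun x => ⟨τ⁻¹ * (x : Γ), ?_⟩) ⟨fun x y e => ?_, fun δ => ?_⟩)
  · have hx := (mem_filter.mp x.2).2
    rw [QuotientGroup.eq] at hx
    simpa using D.inv_mem hx
  · exact Subtype.ext (mul_left_cancel (Subtype.ext_iff.mp e))
  · refine ⟨⟨τ * δ, mem_filter.mpr ⟨mem_univ _, ?_⟩⟩, Subtype.ext (by simp)⟩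
    rw [QuotientGroup.eq, mul_inv_rev, mul_assoc, inv_mul_cancel, mul_one]
    exact D.inv_mem δ.2

variable (Γ₀ D) in
/-- **The cosets `σ_i`**: `{τD | τ ∈ Γ₀} ⊂ Γ/D` («`σ_i = τ_{di}D`, `i = 0, …, (n/d) − 1`»), as a `Finset`. [cite: Milne1999, §6 p. 70 L12] -/
def halfCosets : Finset (Γ ⧸ D) :=
  (univ.filter (· ∈ Γ₀)).image ((↑) : Γ → Γ ⧸ D)

/-- `τD` is one of the `σ_i` for `τ ∈ Γ₀`. [cite: Milne1999, §6 p. 70 L12] -/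
theorem coe_mem_halfCosets {τ : Γ} (hτ : τ ∈ Γ₀) : (τ : Γ ⧸ D) ∈ halfCosets Γ₀ D :=
  mem_image.mpr ⟨τ, mem_filter.mpr ⟨mem_univ _, hτ⟩, rfl⟩

/-- Every `σ_i` is `τD` for some `τ ∈ Γ₀`. [cite: Milne1999, §6 p. 70 L12] -/
theorem exists_rep_of_mem_halfCosets {c : Γ ⧸ D} (hc : c ∈ halfCosets Γ₀ D) : ∃ τ ∈ Γ₀, (τ : Γ ⧸ D) = c := by
  obtain ⟨τ, hτ, rfl⟩ := mem_image.mp hc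
  exact ⟨τ, (mem_filter.mp hτ).2, rfl⟩

/-- `ισ_i` is not a `σ_j`. [cite: Milne1999, §6 p. 70 L13–L16] -/
theorem smul_not_mem_halfCosets (h : Setting ι Γ₀ D) {c : Γ ⧸ D} (hc : c ∈ halfCosets Γ₀ D) :
    ι • c ∉ halfCosets Γ₀ D := by
  intro hc'
  obtain ⟨τ', hτ', rfl⟩ := exists_rep_of_mem_halfCosets hc
  obtain ⟨τ, hτ, e⟩ := exists_rep_of_mem_halfCosets hc'
  exact h.smul_coe_ne_coe hτ hτ' e.symm

/-- For `D ⊂ Γ₀` and `τ ∈ Γ₀`, every `τ′` with `τ′D = τD` lies in `Γ₀`, so the fibre of `Γ₀ → Γ/D` over `τD` is the whole coset, of size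
`d`. [cite: Milne1999, §6 p. 69 L10–L14] -/
theorem card_filter_mem_coe_eq (hD : D ≤ Γ₀) {τ : Γ} (hτ : τ ∈ Γ₀) :
    ((univ.filter (· ∈ Γ₀)).filter fun τ' : Γ => (τ' : Γ ⧸ D) = (τ : Γ ⧸ D)).card = Fintype.card D := by
  rw [← card_filter_coe_eq (D := D) τ]
  congr 1
  ext τ'
  simp only [mem_filter, mem_univ, true_and, and_iff_right_iff_imp]
  intro e
  rw [QuotientGroup.eq] at e
  have : τ * (τ'⁻¹ * τ)⁻¹ ∈ Γ₀ := Γ₀.mul_mem hτ (Γ₀.inv_mem (hD e))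
  rwa [mul_inv_rev, inv_inv, mul_inv_cancel_left] at this

/-- **`(n/d)·d = n`**: `|{σ_i}| · |D| = |Γ₀|` (the `σ_i` are the `D`-cosets inside `Γ₀`, each with `d` elements). [cite: Milne1999, §6 p. 69
L10–L14, p. 70 L12] -/
theorem card_halfCosets_mul_card (hD : D ≤ Γ₀) :
    (halfCosets Γ₀ D).card * Fintype.card D = (univ.filter (· ∈ Γ₀) : Finset Γ).card := by
  rw [card_eq_sum_card_image ((↑) : Γ → Γ ⧸ D) (univ.filter (· ∈ Γ₀))]
  refine (sum_const_nat fun c hc => ?_).symm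
  obtain ⟨τ, hτ, rfl⟩ := exists_rep_of_mem_halfCosets hc
  exact card_filter_mem_coe_eq hD hτ

variable (ι Γ₀ D) in
/-- The numbering map `{σ_i} ⊔ {σ_i} → Γ/D`, `inl σ ↦ σ`, `inr σ ↦ ισ`. [cite: Milne1999, §6 p. 70 L16–L17 («the basis `{σ₀, …, σ_{n/d−1},
ισ₀, …, ισ_{n/d−1}}` of `ℤ[Γ/D]`»)] -/
def frameFun : ↥(halfCosets Γ₀ D) ⊕ ↥(halfCosets Γ₀ D) → Γ ⧸ D
  | Sum.inl c => c
  | Sum.inr c => ι • (c : Γ ⧸ D)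

/-- The `σ_i` and the `ισ_i` are pairwise distinct. [cite: Milne1999, §6 p. 70 L16–L17] -/
theorem frameFun_injective (h : Setting ι Γ₀ D) : Function.Injective (frameFun ι Γ₀ D) := by
  intro a b e
  rcases a with c | c <;> rcases b with c' | c'
  · exact congrArg Sum.inl (Subtype.ext e)
  · exact absurd (show ι • (c' : Γ ⧸ D) ∈ halfCosets Γ₀ D by rw [← show (c : Γ ⧸ D) = ι • (c' : Γ ⧸ D) from e]; exact c.2)
      (smul_not_mem_halfCosets h c'.2)
  · exact absurd (show ι • (c : Γ ⧸ D) ∈ halfCosets Γ₀ D by rw [show ι • (c : Γ ⧸ D) = (c' : Γ ⧸ D) from e]; exact c'.2)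
      (smul_not_mem_halfCosets h c.2)
  · exact congrArg Sum.inr (Subtype.ext (MulAction.injective ι e))

/-- The `σ_i` and the `ισ_i` exhaust `Γ/D` (`Γ = Γ₀ ∪ ιΓ₀`). [cite: Milne1999, §6 p. 70 L16–L17] -/
theorem frameFun_surjective (h : Setting ι Γ₀ D) : Function.Surjective (frameFun ι Γ₀ D) := by
  intro c
  induction c using QuotientGroup.induction_on with | H γ => ?_
  rcases h.mem_or_mem γ with hγ | hγ
  · exact ⟨Sum.inl ⟨γ, coe_mem_halfCosets hγ⟩, rfl⟩
  · refine ⟨Sum.inr ⟨(ι * γ : Γ), coe_mem_halfCosets hγ⟩, ?_⟩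
    change ι • ((ι * γ : Γ) : Γ ⧸ D) = (γ : Γ ⧸ D)
    rw [MulAction.Quotient.smul_coe, smul_eq_mul, ← mul_assoc, h.mul_self, one_mul]

/-- **The numbering `{σ₀, …, σ_{n/d−1}, ισ₀, …, ισ_{n/d−1}}` of `Γ/D`** as a bijection `{σ_i} ⊔ {σ_i} ≃ Γ/D`. [cite: Milne1999, §6 p. 70
L16–L17] -/
def frame (h : Setting ι Γ₀ D) : ↥(halfCosets Γ₀ D) ⊕ ↥(halfCosets Γ₀ D) ≃ Γ ⧸ D :=
  Equiv.ofBijective (frameFun ι Γ₀ D) ⟨frameFun_injective h, frameFun_surjective h⟩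

/-- [cite: Milne1999, §6 p. 70 L16–L17] -/
@[simp] theorem frame_inl (h : Setting ι Γ₀ D) (c : ↥(halfCosets Γ₀ D)) : frame h (Sum.inl c) = (c : Γ ⧸ D) := rfl

/-- [cite: Milne1999, §6 p. 70 L16–L17] -/
@[simp] theorem frame_inr (h : Setting ι Γ₀ D) (c : ↥(halfCosets Γ₀ D)) : frame h (Sum.inr c) = ι • (c : Γ ⧸ D) := rfl

/-- [cite: Milne1999, §6 p. 70 L16–L17] -/
@[simp] theorem frame_symm_coe (h : Setting ι Γ₀ D) (c : ↥(halfCosets Γ₀ D)) : (frame h).symm (c : Γ ⧸ D) = Sum.inl c :=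
  (Equiv.symm_apply_eq _).mpr rfl

/-- [cite: Milne1999, §6 p. 70 L16–L17] -/
@[simp] theorem frame_symm_smul_coe (h : Setting ι Γ₀ D) (c : ↥(halfCosets Γ₀ D)) :
    (frame h).symm (ι • (c : Γ ⧸ D)) = Sum.inr c :=
  (Equiv.symm_apply_eq _).mpr rfl

/-- `ι` acts on the numbering by swapping the two halves. [cite: Milne1999, §6 p. 70 L16–L17] -/
theorem smul_frame (h : Setting ι Γ₀ D) (t : ↥(halfCosets Γ₀ D) ⊕ ↥(halfCosets Γ₀ D)) : ι • frame h t = frame h (Sum.swap t) := by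
  rcases t with c | c
  · rfl
  · exact h.smul_smul_eq c

section PushPsi

variable [DecidableEq Γ]

/-- **The image of `ψ_τ` under `Σ f(τ)τ ↦ Σ f(τ)(τD)` is `ϖ` of the coset `σ = τD`**: `push(ψ_τ) = σ − ισ + dΣ_i ισ_i` (= `σ_i + dισ₀ + ⋯ +
(d − 1)ισ_i + ⋯` for `σ = σ_i`; each `ισ_j` is hit by the `d` elements `τ′ ∈ τ_{dj}D` of `Γ₀`, minus once `τ′ = τ`).
[cite: Milne1999, §6 p. 70 L12–L15] -/
theorem pushFun_psi (h : Setting ι Γ₀ D) {τ : Γ} (hτ : τ ∈ Γ₀) :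
    pushFun R ((↑) : Γ → Γ ⧸ D) (psi ι Γ₀ R τ) =
      Finsupp.single (τ : Γ ⧸ D) 1 - Finsupp.single (ι • (τ : Γ ⧸ D)) 1
        + (Fintype.card D : R) • ∑ k : ↥(halfCosets Γ₀ D), Finsupp.single (ι • (k : Γ ⧸ D)) 1 := by
  have key : ∑ τ' ∈ univ.filter (· ∈ Γ₀), Finsupp.single (ι • (τ' : Γ ⧸ D)) (1 : R) =
      ∑ c ∈ halfCosets Γ₀ D, (Fintype.card D : R) • Finsupp.single (ι • c) 1 := by
    refine (Finset.sum_image' _ fun τ₁ hτ₁ => ?_).symm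
    rw [Finset.sum_congr rfl fun τ' hτ' => by rw [(mem_filter.mp hτ').2], sum_const,
      card_filter_mem_coe_eq h.le (mem_filter.mp hτ₁).2, Nat.cast_smul_eq_nsmul]
  rw [psi, map_add, pushFun_single, map_sum, Finset.sum_erase_eq_sub (mem_filter.mpr ⟨mem_univ _, hτ⟩)]
  simp_rw [pushFun_single]
  rw [show ∀ γ : Γ, ((ι * γ : Γ) : Γ ⧸ D) = ι • (γ : Γ ⧸ D) from fun γ => rfl]
  simp_rw [show ∀ γ : Γ, ((ι * γ : Γ) : Γ ⧸ D) = ι • (γ : Γ ⧸ D) from fun γ => rfl]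
  rw [key, ← Finset.smul_sum, ← Finset.sum_coe_sort]
  abel

/-- The image of `ιψ_τ`: `push(ιψ_τ) = ισ − σ + dΣ_i σ_i` (`= ιϖ`). [cite: Milne1999, §6 p. 70 L15–L16] -/
theorem pushFun_act_iota_psi (h : Setting ι Γ₀ D) {τ : Γ} (hτ : τ ∈ Γ₀) :
    pushFun R ((↑) : Γ → Γ ⧸ D) (act R ι (psi ι Γ₀ R τ)) =
      Finsupp.single (ι • (τ : Γ ⧸ D)) 1 - Finsupp.single (τ : Γ ⧸ D) 1
        + (Fintype.card D : R) • ∑ k : ↥(halfCosets Γ₀ D), Finsupp.single (k : Γ ⧸ D) 1 := by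
  rw [pushFun_act R ((↑) : Γ → Γ ⧸ D) (g := ι) (fun _ => rfl), pushFun_psi R h hτ, map_add, map_sub, map_smul, map_sum, act_single, act_single, h.smul_smul_eq]
  simp_rw [act_single, h.smul_smul_eq]

end PushPsi

end Setting

/-! ### §3 LEMMA 6.7's computation: the matrix and the kernel of any `θ : ℤ[Γ/D] → ℤ[Γ/D]` with the printed basis values -/

section Kernel

variable {Γ : Type*} [Group Γ] {ι : Γ} {Γ₀ D : Subgroup Γ}
variable [Fintype Γ] [DecidablePred (· ∈ Γ₀)] [DecidablePred (· ∈ D)]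
variable (R : Type*) [CommRing R] (h : Setting ι Γ₀ D)

include h

/-- **The basis `{σ₀, …, σ_{n/d−1}, ισ₀, …, ισ_{n/d−1}}` of `ℤ[Γ/D]`** (the standard basis renumbered by `frame`).
[cite: Milne1999, §6 p. 70 L16–L17] -/
def cosetBasis : Module.Basis (↥(halfCosets Γ₀ D) ⊕ ↥(halfCosets Γ₀ D)) R (Γ ⧸ D →₀ R) :=
  Finsupp.basisSingleOne.reindex (frame h).symm

/-- [cite: Milne1999, §6 p. 70 L16–L17] -/
theorem cosetBasis_apply (t : ↥(halfCosets Γ₀ D) ⊕ ↥(halfCosets Γ₀ D)) : cosetBasis R h t = Finsupp.single (frame h t) 1 := by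
  rw [cosetBasis, Module.Basis.reindex_apply, Equiv.symm_symm, Finsupp.coe_basisSingleOne]

/-- [cite: Milne1999, §6 p. 70 L16–L17] -/
theorem cosetBasis_repr (f : Γ ⧸ D →₀ R) (t : ↥(halfCosets Γ₀ D) ⊕ ↥(halfCosets Γ₀ D)) :
    (cosetBasis R h).repr f t = f (frame h t) := by
  rw [cosetBasis, Module.Basis.repr_reindex_apply, Equiv.symm_symm, Finsupp.basisSingleOne_repr, LinearEquiv.refl_apply]

/-- A linear map `θ : ℤ[Γ/D] → ℤ[Γ/D]` read in the numbering `frame` (conjugation by `Finsupp.domLCongr`). [cite: Milne1999, §6 p. 70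
L16–L17] -/
def transport (θ : (Γ ⧸ D →₀ R) →ₗ[R] (Γ ⧸ D →₀ R)) :
    (↥(halfCosets Γ₀ D) ⊕ ↥(halfCosets Γ₀ D) →₀ R) →ₗ[R] (↥(halfCosets Γ₀ D) ⊕ ↥(halfCosets Γ₀ D) →₀ R) :=
  (Finsupp.domLCongr (frame h).symm).toLinearMap ∘ₗ θ ∘ₗ (Finsupp.domLCongr (frame h)).toLinearMap

/-- [cite: Milne1999, §6 p. 70 L16–L17] -/
theorem transport_apply (θ : (Γ ⧸ D →₀ R) →ₗ[R] (Γ ⧸ D →₀ R)) (g : ↥(halfCosets Γ₀ D) ⊕ ↥(halfCosets Γ₀ D) →₀ R)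
    (s : ↥(halfCosets Γ₀ D) ⊕ ↥(halfCosets Γ₀ D)) :
    transport R h θ g s = θ (Finsupp.equivMapDomain (frame h) g) (frame h s) := by
  rw [transport, LinearMap.comp_apply, LinearMap.comp_apply, LinearEquiv.coe_toLinearMap, LinearEquiv.coe_toLinearMap,
    Finsupp.domLCongr_apply, Finsupp.domLCongr_apply, Finsupp.domCongr_apply, Finsupp.domCongr_apply, Finsupp.equivMapDomain_apply,
    Equiv.symm_symm]

variable {R}

/-- The hypothesis `d(2 − (n/d)d) ≠ 0` of Corollary 6.6 for `A(n/d, d)` in the form `d ≠ 0`, `2 − n ≠ 0` in `R` (`n = |Γ₀|`).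
[cite: Milne1999, §6 p. 70 L17–L19; p. 68 Corollary 6.6] -/
theorem card_hyp [NoZeroDivisors R] (hd : (Fintype.card D : R) ≠ 0) (hn : (2 : R) - ((univ.filter (· ∈ Γ₀) : Finset Γ).card : R) ≠ 0) :
    (Fintype.card D : R) * (2 - (Fintype.card ↥(halfCosets Γ₀ D) : R) * (Fintype.card D : R)) ≠ 0 := by
  rw [Fintype.card_coe, ← Nat.cast_mul, card_halfCosets_mul_card h.le]
  exact mul_ne_zero hd hn

variable [DecidableEq Γ]

/-- The hypothesis of §3: `θ` takes the printed values on the basis — `θ(σ) = push(ψ_τ)`, `θ(ισ) = push(ιψ_τ)` for `σ = τD`, `τ ∈ Γ₀`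
(for Milne's composite `ℤ[Γ/D] → X^*(L^Π) → X^*(P^K) → ℤ[Γ/D]` these are `σ_i ↦ [π_i] ↦ f_{π_i} = push(ψ_{di})` by Lemma 5.1's diagram).
[cite: Milne1999, §6 p. 70 L8–L16] -/
structure HasPrintedValues (θ : (Γ ⧸ D →₀ R) →ₗ[R] (Γ ⧸ D →₀ R)) : Prop where
  /-- `θ(τD) = push(ψ_τ)` -/
  coe : ∀ τ ∈ Γ₀, θ (Finsupp.single (τ : Γ ⧸ D) 1) = pushFun R ((↑) : Γ → Γ ⧸ D) (psi ι Γ₀ R τ)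
  /-- `θ(ιτD) = push(ιψ_τ)` -/
  smul_coe : ∀ τ ∈ Γ₀, θ (Finsupp.single (ι • (τ : Γ ⧸ D)) 1) = pushFun R ((↑) : Γ → Γ ⧸ D) (act R ι (psi ι Γ₀ R τ))

variable {θ : (Γ ⧸ D →₀ R) →ₗ[R] (Γ ⧸ D →₀ R)}

/-- **In the numbering, `θ` IS the coordinate endomorphism `theta d`** (`d = |D|`): «Since `σ_iϖ₀ = ϖ_i`, `ισ_iϖ₀ = ιϖ_i` …».
[cite: Milne1999, §6 p. 70 L15–L17] -/
theorem transport_eq_theta (hθ : HasPrintedValues (ι := ι) (Γ₀ := Γ₀) θ) :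
    transport R h θ = theta (Fintype.card D : R) := by
  refine (Finsupp.basisSingleOne (R := R)).ext fun t => ?_
  rw [Finsupp.coe_basisSingleOne, theta_single, one_smul]
  rcases t with c | c
  · obtain ⟨τ, hτ, hc⟩ := exists_rep_of_mem_halfCosets c.2
    rw [transport, LinearMap.comp_apply, LinearMap.comp_apply, LinearEquiv.coe_toLinearMap, LinearEquiv.coe_toLinearMap,
      Finsupp.domLCongr_single, frame_inl, ← hc, hθ.coe τ hτ, pushFun_psi R h hτ, map_add, map_sub, map_smul, map_sum,
      Finsupp.domLCongr_single, Finsupp.domLCongr_single, hc, frame_symm_coe, frame_symm_smul_coe]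
    simp_rw [Finsupp.domLCongr_single, frame_symm_smul_coe]
    rfl
  · obtain ⟨τ, hτ, hc⟩ := exists_rep_of_mem_halfCosets c.2
    rw [transport, LinearMap.comp_apply, LinearMap.comp_apply, LinearEquiv.coe_toLinearMap, LinearEquiv.coe_toLinearMap,
      Finsupp.domLCongr_single, frame_inr, ← hc, hθ.smul_coe τ hτ, pushFun_act_iota_psi R h hτ, map_add, map_sub, map_smul, map_sum,
      Finsupp.domLCongr_single, Finsupp.domLCongr_single, hc, frame_symm_coe, frame_symm_smul_coe]
    simp_rw [Finsupp.domLCongr_single, frame_symm_coe]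
    rfl

/-- **«this composite map has matrix `A(n/d, d)` relative to the basis `{σ₀, …, σ_{n/d−1}, ισ₀, …, ισ_{n/d−1}}` of `ℤ[Γ/D]`»** — for any
linear `θ` with the printed basis values. [cite: Milne1999, §6 p. 70 L16–L17 (proof of Lemma 6.7)] -/
theorem toMatrix_eq_matA (hθ : HasPrintedValues (ι := ι) (Γ₀ := Γ₀) θ) :
    LinearMap.toMatrix (cosetBasis R h) (cosetBasis R h) θ = matA (Fintype.card D : R) := by
  ext s t
  rw [LinearMap.toMatrix_apply, cosetBasis_repr, cosetBasis_apply, ← varpi_apply, ← one_smul R (varpi _ t), ← theta_single,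
    ← transport_eq_theta h hθ, transport_apply, Finsupp.equivMapDomain_single]

/-- **«Now Corollary 6.6 implies that the kernel of the composite map is `{Σ a_i(σ_i + ισ_i) | Σ a_i = 0}`»**: for `R` without zero
divisors with `2 ≠ 0` and `d(2 − (n/d)d) ≠ 0` (`d = |D|`, `n/d = |{σ_i}|`), `θ f = 0 ⟺ f(ιc) = f(c)` for every coset `c` and `Σ_c f(c) = 0`.
[cite: Milne1999, §6 p. 70 L17–L19 (proof of Lemma 6.7); p. 68 Corollary 6.6] -/
theorem mem_ker_iff [NoZeroDivisors R] (hθ : HasPrintedValues (ι := ι) (Γ₀ := Γ₀) θ) (h2 : (2 : R) ≠ 0)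
    (hd : (Fintype.card D : R) * (2 - (Fintype.card ↥(halfCosets Γ₀ D) : R) * (Fintype.card D : R)) ≠ 0) (f : Γ ⧸ D →₀ R) :
    θ f = 0 ↔ (∀ c : Γ ⧸ D, f (ι • c) = f c) ∧ ∑ c, f c = 0 := by
  have hf : Finsupp.equivMapDomain (frame h) (Finsupp.equivMapDomain (frame h).symm f) = f := by
    ext c
    simp only [Finsupp.equivMapDomain_apply, Equiv.symm_symm, Equiv.apply_symm_apply]
  have e1 : θ f = 0 ↔ transport R h θ (Finsupp.equivMapDomain (frame h).symm f) = 0 := by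
    constructor
    · intro H
      ext s
      rw [transport_apply, hf, H, Finsupp.zero_apply, Finsupp.zero_apply]
    · intro H
      ext c
      have := DFunLike.congr_fun H ((frame h).symm c)
      rw [transport_apply, hf, Equiv.apply_symm_apply, Finsupp.zero_apply] at this
      rw [this, Finsupp.zero_apply]
  rw [e1, transport_eq_theta h hθ, theta_eq_zero_iff_swap h2 hd]
  simp only [Finsupp.equivMapDomain_apply, Equiv.symm_symm]
  refine and_congr ⟨fun H c => ?_, fun H s => ?_⟩ ?_
  · obtain ⟨s, rfl⟩ := (frame h).surjective c
    rw [smul_frame]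
    exact H s
  · rw [← smul_frame]
    exact H _
  · rw [Equiv.sum_comp (frame h) ⇑f]

omit [DecidableEq Γ] h in
/-- The relation module `{f | ιf = f, Σ f = 0}` of `Γ/D` (the kernel of «the natural map `ℤ[Π] → X^*(L^Π)`» along `Γ/D ≅ Π`) unfolded
pointwise. [cite: Milne1999, §6 p. 70 L19–L20; §2 p. 55 L38–L45] -/
theorem mem_rel_iff_forall (f : Γ ⧸ D →₀ R) : f ∈ rel R (Γ ⧸ D) ι ↔ (∀ c : Γ ⧸ D, f (ι • c) = f c) ∧ ∑ c, f c = 0 := by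
  rw [mem_rel_iff]
  refine and_congr ⟨fun H c => ?_, fun H => ?_⟩ ?_
  · have := DFunLike.congr_fun H (ι • c)
    rw [act, Finsupp.lmapDomain_apply, Finsupp.mapDomain_apply (MulAction.injective ι)] at this
    exact this.symm
  · ext c
    obtain ⟨c', rfl⟩ := MulAction.surjective ι c
    rw [act, Finsupp.lmapDomain_apply, Finsupp.mapDomain_apply (MulAction.injective ι), H]
  · rw [aug, Finsupp.linearCombination_apply, Finsupp.sum_fintype f (fun _ (a : R) => a • (1 : R)) (fun _ => zero_smul _ _)]
    simp only [smul_eq_mul, mul_one]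

/-- **LEMMA 6.7's kernel**: `Ker θ = {f | ιf = f, Σ f = 0}` («… but this is also the kernel of the map `ℤ[Γ/D] → X^*(L^Π)`» — the relation
module `OrbitTorus.rel` defining `X^*(L^Π) = ℤ[Π]/rel`). [cite: Milne1999, §6 p. 70 L17–L20 (proof of Lemma 6.7)] -/
theorem ker_eq_rel [NoZeroDivisors R] (hθ : HasPrintedValues (ι := ι) (Γ₀ := Γ₀) θ) (h2 : (2 : R) ≠ 0)
    (hd : (Fintype.card D : R) * (2 - (Fintype.card ↥(halfCosets Γ₀ D) : R) * (Fintype.card D : R)) ≠ 0) :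
    LinearMap.ker θ = rel R (Γ ⧸ D) ι := by
  ext f
  rw [LinearMap.mem_ker, mem_ker_iff h hθ h2 hd, mem_rel_iff_forall]

/-- **LEMMA 6.7's kernel over `ℤ`** (the printed lattice): for `|Γ₀| ≠ 2`, `Ker θ = {f | ιf = f, Σ f = 0}`. [cite: Milne1999, §6 p. 70
L17–L20 (proof of Lemma 6.7)] -/
theorem int_ker_eq_rel {θ : (Γ ⧸ D →₀ ℤ) →ₗ[ℤ] (Γ ⧸ D →₀ ℤ)} (hθ : HasPrintedValues (ι := ι) (Γ₀ := Γ₀) θ)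
    (hn : ((univ.filter (· ∈ Γ₀) : Finset Γ).card) ≠ 2) : LinearMap.ker θ = rel ℤ (Γ ⧸ D) ι := by
  refine ker_eq_rel h hθ two_ne_zero (card_hyp h ?_ ?_)
  · exact_mod_cast Fintype.card_ne_zero
  · rw [sub_ne_zero]
    exact_mod_cast (Ne.symm hn : (2 : ℕ) ≠ _)

omit [Fintype Γ] [DecidableEq Γ] [DecidablePred (· ∈ Γ₀)] [DecidablePred (· ∈ D)] h in
/-- If a linear map out of the character module `X = R[S]/rel` becomes, after composition with `R[S] ↠ X`, a map with kernel `⊆ rel`, it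
is injective. [cite: Milne1999, §6 p. 70 L5–L6, L19–L20 (proof of Lemma 6.7)] -/
theorem injective_of_comp_mkQ {S : Type*} [MulAction Γ S] {M : Type*} [AddCommGroup M] [Module R M]
    (g : CharModule R S ι →ₗ[R] M) (hk : LinearMap.ker (g ∘ₗ (rel R S ι).mkQ) ≤ rel R S ι) : Function.Injective g := by
  rw [← LinearMap.ker_eq_bot, Submodule.eq_bot_iff]
  intro x hx
  induction x using Submodule.Quotient.induction_on with | H f => ?_
  exact (Submodule.Quotient.mk_eq_zero _).mpr (hk (by rwa [LinearMap.mem_ker, LinearMap.comp_apply, Submodule.mkQ_apply]))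

/-- **LEMMA 6.7, the mechanism «we shall prove this by showing that the bottom map is injective»**: if the composite
`ℤ[Γ/D] ↠ X −b→ M′ −r→ ℤ[Γ/D]` (`X = ℤ[Γ/D]/{ιf = f, Σ f = 0}` the character module — `X^*(L^Π)` along `Γ/D ≅ Π` — `b` any linear map, e.g.
`X^*(β)`, `r` any linear map, e.g. `π ↦ (σ ↦ f_π(σw₀))`) takes the printed values on the basis, then `b` is injective (`2 ≠ 0`,
`d(2 − (n/d)d) ≠ 0` in `R`). [cite: Milne1999, §6 p. 70 L5–L20 (proof of Lemma 6.7)] -/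
theorem injective_of_hasPrintedValues [NoZeroDivisors R] {M' : Type*} [AddCommGroup M'] [Module R M']
    (b : CharModule R (Γ ⧸ D) ι →ₗ[R] M') (r : M' →ₗ[R] (Γ ⧸ D →₀ R))
    (hθ : HasPrintedValues (ι := ι) (Γ₀ := Γ₀) (r ∘ₗ b ∘ₗ (rel R (Γ ⧸ D) ι).mkQ)) (h2 : (2 : R) ≠ 0)
    (hd : (Fintype.card D : R) * (2 - (Fintype.card ↥(halfCosets Γ₀ D) : R) * (Fintype.card D : R)) ≠ 0) :
    Function.Injective b := by
  have hrb : Function.Injective (r ∘ₗ b) :=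
    injective_of_comp_mkQ (r ∘ₗ b) (le_of_eq (by rw [LinearMap.comp_assoc, ker_eq_rel h hθ h2 hd]))
  exact Function.Injective.of_comp (f := r) (by simpa using hrb)

end Kernel

end CosetGerm

end Literature.NumberTheory.ComplexMultiplication
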